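import Summits.QuantumFields.BalabanUV.Gaps.D4WalkGlue
import Summits.QuantumFields.BalabanUV.T4Continuum.Spine.NE5.TwoRunPencilWalks

/-!
# Spine/NE5/TwoRunPencilGlue — row NE5's two-run pencil taken at the LOCAL-DATA level passes through the (3.87)–(3.90) gluing of
# [B9] Thm 3.7 ∕ 3.10 with a `t`-UNIFORM package: no differencing of glued kernels or chains is ever needed (cell `pub-balaban-gaps`, seat `ne5` gen 6)

WHY (triage sheet `HOME/ne/NE5.md` §7 (r4′) ∕ (r3″), §11 (x4)).  NE5 compares run A (spacing η, read through the transport) with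
run B (spacing η∕L) at the paired scale.  Its W2 datum is the H-layer along the complex PENCIL between the two runs' step DATA,
and the E-layer Cauchy estimate (`Spine/NE5/EnvelopeFromActivities`) turns `t`-holomorphy + a `t`-uniform majorant on the disc
`‖t‖ ≤ s∕r_j` into the two-run rate `r_j∕s`.  Gen 5 typed the pencil one layer below the activities, in row (D4)'s NODE-O
walk-expansion currency (`TwoRunPencilWalks.jointWalkExpansion_pencil(_reach ∕ Param)`: pencil members of two termwise-close
`JointWalkExpansion`s are `JointWalkExpansion`s with letters ×`(1 + s)`), and recorded the located junction (r4′): IF the pencil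
is taken between the two runs' ASSEMBLED kernels (Γ-kernel, precision), the termwise closeness it needs is one rate drop below
the local-factor rate, because a walk term is a product of `n(ω)` local factors and its two-run difference telescopes (King,
CMP **102** p. 665 *"the error is the same graph with a difference of propagators on one line"*).  Since then the (D4) seat
g1-p2 typed [B9]'s GLUING at one scale in the same currency (`Gaps/D4WalkGlue.jointWalkExpansion_glue`, p355792): the
Γ-kernel of a step is the glued inverse `S·(1 − R)⁻¹` of a SEED family `S = Σ_□ h_□G′_□h_□` and a STEP family
`R = Σ_□ K(h_□)G′_□h_□` ((3.87)–(3.88) p. 409) — the LOCAL DATA of the step.  THIS FILE records the consequence for NE5: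

* §1 `jointWalkExpansion_glue_pencil` — take the pencil at the local-data level: `S_t := S_A + t(S_B − S_A)`,
  `R_t := R_A + t(R_B − R_A)` with the two runs' seed ∕ step TERMS close at the local two-run rate `r` (row NE2's currency for
  the LOCAL cube problems at two spacings: `‖T^B_ω − T^A_ω‖ ≤ r·A_ω e^{−ρD_ω}` termwise, NO rate drop); then for every `t` in the
  reach disc `‖t‖ ≤ s∕r` the glued kernel `S_t·(1 − R_t)⁻¹` is a `JointWalkExpansion` (∃-packaged as `TermWalkData` consumes it)
  whose package — ball, window, torus rate, CONSTANT `(mc₁)·(1 + s)K̄_S·(1 − q_s)⁻¹·c′` with margin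
  `q_s = (mc₁)((mc₁)(1 + s)K̄_R c′)c′` — mentions NEITHER `t` NOR the rate `r`.  Composition BY NAME:
  `jointWalkExpansion_pencil_reach` (×2) → `jointWalkExpansion_glue`.  So as `r = r_j → 0` the Γ-slot of Lemma 3's input holds
  on the whole NE5 pencil with ONE package, and the pencil's two ends ARE the two runs' glued kernels (`pencil_zero ∕ pencil_one`; both inside the disc when `r ≤ s`, `TwoRunPencilWalks.runs_mem_reach_disc`).
* §2 `jointWalkExpansion_glue_pencilParam` — the interpolation parameter as one more configuration coordinate: over `E × ℂ`
  the glued family `(u, t) ↦ S(u,t)·(1 − R(u,t))⁻¹` is a `JointWalkExpansion` on the `R`-ball, hence (g1-p2's projection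
  `.analyticOnBall`) its entries are JOINTLY holomorphic in (row (D4)'s background seam, row NE5's interpolation parameter) —
  the `t`-holomorphy the E-layer Cauchy estimate consumes, for the GLUED kernel, with no separate argument.
CONSEQUENCE FOR THE LEDGER (r4″, recorded in `ne/NE5.md` v6): for the Γ-slot the rate drop of (r4′) is NOT incurred and King's
telescoping is NOT needed — holomorphy in `t` at the data level replaces it wholesale; the two-run rate need only be supplied for
the LOCAL seed ∕ step factors (row NE2 ∕ NE3's local cube operators at two spacings, read through the transport), never for
glued kernels, walk terms or chains.  The same holds for the precision (linear in the data) and for the covariance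
(`NeumannPencilCovariance.walkMajorants_inv_pencil_reach`, gen 5): NE5's whole W2 input is `t`-uniform on the data pencil.

HONEST FRAMING.  Bookkeeping: a two-line composition of LANDED theorems over hypothesis SHAPES; the four families, their
closeness `r`, the reach `s` and every constant are HYPOTHESES ∕ parameters; nothing of Bałaban's is constructed or asserted
(whether his `h_□G′_□h_□`, `K(h_□)G′_□h_□` at two spacings admit such data is NODE O, instance 0∕1, + rows NE2∕NE3); NE5 NOT
PRINTED ∕ NOT PROVED; (D4) NOT discharged; 0∕12 NE5 leaves on Bałaban's objects; classification words UNCHANGED.  Rung (B)+1 on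
a FIXED finite T⁴ — NOT continuum by itself, NOT infinite volume, NOT mass gap, NOT Clay.  Spine PROVED 0∕9.  HONEST DEPENDENCY:
continuum YM on T⁴ ⇐ BetaPertH ∧ nine spine estimates; BetaPertH ⇐ (D1) ∧ (D4) ∧ CAP+tail.  0 sorry, 0 `def`, 0 new `Prop`.

Sources: [B9] = T. Bałaban, CMP **99** (1985) 389–434 [Balaban1985BackgroundPropagators] (3.87)–(3.90) p. 409–410, Thm 3.10
(3.107)–(3.108) p. 416, (3.130) p. 421–422; [II] = CMP **116** (1988) [Balaban1988RG2Cluster] (1.5) p. 3, (1.11) p. 5, p. 13, p. 15;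
C. King, CMP **102** (1986) [King1986] p. 665.  Nothing here is a claim about the Yang–Mills mass gap.
-/

noncomputable section

namespace Summit.QuantumFields.BalabanUV.T4Continuum.Spine.NE5.TwoRunPencilGlue

open Metric Set
open Literature.MathematicalPhysics.QuantumFieldTheory.Balaban1983to89
open Literature.MathematicalPhysics.QuantumFieldTheory.Balaban1983to89.B9SectDWalk (DomBy)
open Literature.MathematicalPhysics.QuantumFieldTheory.Balaban1983to89.B9Thm34Ext (toB6)
open Literature.MathematicalPhysics.QuantumFieldTheory.Balaban1983to89.B9Thm37GlueTorus (torusGeom)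
open Literature.MathematicalPhysics.QuantumFieldTheory.Balaban1983to89.TreeLengthTorus (TPt)
open Literature.MathematicalPhysics.QuantumFieldTheory.Balaban1983to89.B5TorusCover (UT)
open Literature.MathematicalPhysics.QuantumFieldTheory.Balaban1983to89.B11SectG (RowSum)
open Literature.MathematicalPhysics.QuantumFieldTheory.Balaban1983to89.B13JointWalkExpansion (JointWalkExpansion)
open Summit.QuantumFields.BalabanUV.Gaps.D4WalkGlue (jointWalkExpansion_glue)
open Summit.QuantumFields.BalabanUV.T4Continuum.Spine.NE5.TwoRunPencilWalks
  (jointWalkExpansion_pencil_reach jointWalkExpansion_pencilParam)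

variable {ν : ℕ} {Nf : Fin ν → ℕ} [∀ i, NeZero (Nf i)]
variable {d N' : ℕ} {p n : Type} [Fintype n] [DecidableEq n]
variable {E : Type*} [NormedAddCommGroup E] [NormedSpace ℂ E]
variable {c₀ : B13.Consts} {locp : p → UT Nf} {locn : n → UT Nf} {X : Finset (UT Nf)}
-- the two runs' SEED families (shared walk skeleton `WS, SXS, DS`) and STEP families (shared `WR, SXR, DR`)
variable {SA SB : (TPt d N' → ℂ) → E → Matrix p n ℂ} {RA RB : (TPt d N' → ℂ) → E → Matrix n n ℂ}
variable {WS WR : Type} {TSA TSB : WS → (TPt d N' → ℂ) → E → Matrix p n ℂ} {TRA TRB : WR → (TPt d N' → ℂ) → E → Matrix n n ℂ}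
variable {SXS : Set WS} {SXR : Set WR} {AS ASB : WS → ℝ} {AR ARB : WR → ℝ}
variable {DS : WS → UT Nf → UT Nf → ℝ} {DR : WR → UT Nf → UT Nf → ℝ}
variable {R ρS εS κS KbarS RSB ρSB εSB κSB KbarSB ρR εR κR KbarR RRB ρRB εRB κRB KbarRB : ℝ}
variable {ρ ε ρs σ₁ c₁ σ' c' κs κ ρ' ε' κ' : ℝ} {m : ℕ}

/-! ## §1. The glued inverse along the local-data pencil, reach form -/

omit [∀ i, NeZero (Nf i)] [Fintype n] [DecidableEq n] [NormedAddCommGroup E] [NormedSpace ℂ E] in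
/-- The pencil's `t = 0` end is run A. [folklore] -/
theorem pencil_zero (KA KB : (TPt d N' → ℂ) → E → Matrix p n ℂ) :
    (fun σ₀ u => KA σ₀ u + (0 : ℂ) • (KB σ₀ u - KA σ₀ u)) = KA := by
  funext σ₀ u; simp

omit [∀ i, NeZero (Nf i)] [Fintype n] [DecidableEq n] [NormedAddCommGroup E] [NormedSpace ℂ E] in
/-- The pencil's `t = 1` end is run B. [folklore] -/
theorem pencil_one (KA KB : (TPt d N' → ℂ) → E → Matrix p n ℂ) :
    (fun σ₀ u => KA σ₀ u + (1 : ℂ) • (KB σ₀ u - KA σ₀ u)) = KB := by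
  funext σ₀ u; simp

/-- **THE GLUED KERNEL ALONG NE5's LOCAL-DATA PENCIL IS A JOINT WALK EXPANSION WITH A `t`-FREE, `r`-FREE PACKAGE.**
Data: the two runs' seed families `S_A`, `S_B` (`p × n`, shared skeleton `(W_S, SX_S, D_S)`) and step families `R_A`, `R_B`
(`n × n`, shared `(W_R, SX_R, D_R)`), each a `JointWalkExpansion` on σ-polydisc × `R`-ball (run B's own amplitudes ∕ constants
are not used — only its expansion identity, termwise analyticity and σ-structure; `R ≤ R_B`), TERMWISE CLOSE at the local two-run
rate `r > 0` in walk-weighted currency (`hdiffS`, `hdiffR`); walk distances dominating `d₁`; fibre `m`; row sums `(σ₁,c₁)`,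
`(σ′,c′)`; the Neumann window and the product window of `D4WalkGlue.jointWalkExpansion_glue` with run A's letters INFLATED BY THE
REACH, `K̄ ↦ (1 + s)K̄` (margin `q_s = (mc₁)((mc₁)·1·(1·(1 + s)K̄_R)c′)c′ < 1`).  Conclusion: for every `t ∈ ℂ` with `‖t‖ ≤ s∕r`
the glued kernel `S_t·(1 − R_t)⁻¹`, `S_t = S_A + t(S_B − S_A)`, `R_t = R_A + t(R_B − R_A)`, is a `JointWalkExpansion` at
`(R, ε′, κ′)` with constant `(mc₁)·(1 + s)K̄_S·(1·(1 − q_s)⁻¹)·c′`, ∃-packaged with walk distances dominating `d₁` — no letter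
mentions `t` or `r`.  Composition BY NAME of `TwoRunPencilWalks.jointWalkExpansion_pencil_reach` (twice) and
`D4WalkGlue.jointWalkExpansion_glue`. [cite: Balaban1985BackgroundPropagators, (3.87)–(3.90) p.409, Thm 3.10 p.416, p.422; Balaban1988RG2Cluster, (1.5) p.3, p.13, p.15; King1986, p.665] -/
theorem jointWalkExpansion_glue_pencil
    (hSA : JointWalkExpansion c₀ locp locn SA X R εS κS KbarS TSA SXS AS DS ρS)
    (hSB : JointWalkExpansion c₀ locp locn SB X RSB εSB κSB KbarSB TSB SXS ASB DS ρSB) (hRSB : R ≤ RSB)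
    (hRA : JointWalkExpansion c₀ locn locn RA X R εR κR KbarR TRA SXR AR DR ρR)
    (hRB : JointWalkExpansion c₀ locn locn RB X RRB εRB κRB KbarRB TRB SXR ARB DR ρRB) (hRRB : R ≤ RRB)
    (hSdom : ∀ ω, DomBy (toB6 (torusGeom Nf 0 0 0) 0 True) (DS ω))
    (hRdom : ∀ ω, DomBy (toB6 (torusGeom Nf 0 0 0) 0 True) (DR ω))
    {r s : ℝ} (hr : 0 < r) (hs : 0 ≤ s)
    (hdiffS : ∀ ω, ∀ σ₀ : TPt d N' → ℂ, (∀ j, ‖σ₀ j‖ ≤ Real.exp c₀.κ₁) → ∀ u ∈ ball (0 : E) R,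
      ∀ i j, ‖TSB ω σ₀ u i j - TSA ω σ₀ u i j‖ ≤ r * (AS ω * Real.exp (-(ρS * DS ω (locp i) (locn j)))))
    (hdiffR : ∀ ω, ∀ σ₀ : TPt d N' → ℂ, (∀ j, ‖σ₀ j‖ ≤ Real.exp c₀.κ₁) → ∀ u ∈ ball (0 : E) R,
      ∀ i j, ‖TRB ω σ₀ u i j - TRA ω σ₀ u i j‖ ≤ r * (AR ω * Real.exp (-(ρR * DR ω (locn i) (locn j)))))
    (hfib : ∀ y : UT Nf, (Finset.univ.filter fun k => locn k = y).card ≤ m)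
    (hrow : RowSum (toB6 (torusGeom Nf 0 0 0) 0 True) σ₁ c₁) (hrow' : RowSum (toB6 (torusGeom Nf 0 0 0) 0 True) σ' c')
    (hσ₁ : 0 ≤ σ₁) (hσ' : 0 ≤ σ') (hc₁ : 0 ≤ c₁) (hc' : 0 ≤ c')
    -- step 1 of the gluing: the Neumann window (run A's step letters, constant inflated by the reach)
    (hε : 0 ≤ ε) (hερ : ε ≤ ρ) (hρs : ρ + σ₁ ≤ ρs) (hρsR : ρs + σ₁ ≤ ρR) (hwR : ρR - εR ≤ ρ - ε)
    (hKR : 0 ≤ KbarR) (hκs : 0 ≤ κs) (hκsR : κs ≤ κR) (hκsC : κs + σ' ≤ ρ - ε) (hκ : 0 ≤ κ) (hκC : κ ≤ ρ - ε)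
    (hκκs : κ + σ' ≤ κs)
    (hq : (m * c₁) * ((m * c₁) * 1 * (1 * ((1 + s) * KbarR)) * c') * c' < 1)
    -- step 2 of the gluing: the product window (the seed pays; run A's seed letters)
    (hρ' : 0 ≤ ρ') (hρ'ρ : ρ' ≤ ρ) (hρ'S : ρ' + σ₁ ≤ ρS) (hε' : 0 ≤ ε') (hwS : ρS - εS ≤ ρ' - ε') (hw1 : ρ - ε ≤ ρ' - ε')
    (hKS : 0 ≤ KbarS) (hκ' : 0 ≤ κ') (hκ'κ : κ' ≤ κ) (hκ'S : κ' + σ' ≤ κS)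
    {t : ℂ} (ht : ‖t‖ ≤ s / r) :
    ∃ (W : Type) (T : W → (TPt d N' → ℂ) → E → Matrix p n ℂ) (SX : Set W) (A : W → ℝ) (D : W → UT Nf → UT Nf → ℝ)
      (ρ₀ : ℝ), JointWalkExpansion c₀ locp locn
        (fun σ₀ u => (SA σ₀ u + t • (SB σ₀ u - SA σ₀ u)) *
          ((1 : Matrix n n ℂ) + (-1 : ℂ) • (RA σ₀ u + t • (RB σ₀ u - RA σ₀ u)))⁻¹) X R ε' κ'
        ((m * c₁) * ((1 + s) * KbarS) *
          (1 * (1 - (m * c₁) * ((m * c₁) * 1 * (1 * ((1 + s) * KbarR)) * c') * c')⁻¹) * c') T SX A D ρ₀ ∧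
      ∀ ω, DomBy (toB6 (torusGeom Nf 0 0 0) 0 True) (D ω) :=
  have hs1 : 0 ≤ 1 + s := by positivity
  jointWalkExpansion_glue (jointWalkExpansion_pencil_reach hSA hSB hRSB hr hs hdiffS ht)
    (jointWalkExpansion_pencil_reach hRA hRB hRRB hr hs hdiffR ht) hSdom hRdom hfib hrow hrow' hσ₁ hσ' hc₁ hc' hε hερ hρs
    hρsR hwR (mul_nonneg hs1 hKR) hκs hκsR hκsC hκ hκC hκκs hq hρ' hρ'ρ hρ'S hε' hwS hw1 (mul_nonneg hs1 hKS) hκ' hκ'κ hκ'S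

/-! ## §2. The interpolation parameter as a configuration coordinate: joint analyticity of the glued kernel in (background, t) -/

/-- **THE GLUED KERNEL OVER `E × ℂ`** (row (D4)'s seam ball × row NE5's pencil AT ONCE).  Same data as §1 with a reach `τ ≥ 0`
and rate `r ≥ 0`; the seed ∕ step pencils are read as families over the configuration space `E × ℂ` (reference configuration
`(0,0)` = run A at its base point; parameter scaled by `τ∕R` so that the `R`-ball in `E × ℂ` covers `‖t‖ ≤ τ`), which are
`JointWalkExpansion`s by `TwoRunPencilWalks.jointWalkExpansion_pencilParam`; the gluing then yields a `JointWalkExpansion` OVER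
`E × ℂ` of `(u,t) ↦ S(u,t)·(1 − R(u,t))⁻¹` with constant `(mc₁)·(1 + τr)K̄_S·(1·(1 − q)⁻¹)·c′`, `q = (mc₁)((mc₁)·1·(1·(1 + τr)K̄_R)c′)c′`.
Its projection `.analyticOnBall` (g1-p2, `B13JointWalkExpansion`) is the JOINT holomorphy of every entry of the glued kernel in
(background, interpolation parameter) — the `t`-holomorphy NE5's E-layer Cauchy estimate consumes, for the Γ-slot, with no
separate argument. [cite: Balaban1985BackgroundPropagators, (3.87)–(3.90) p.409, Thm 3.10 p.416; Balaban1988RG2Cluster, (1.5) p.3, p.15] -/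
theorem jointWalkExpansion_glue_pencilParam
    (hSA : JointWalkExpansion c₀ locp locn SA X R εS κS KbarS TSA SXS AS DS ρS)
    (hSB : JointWalkExpansion c₀ locp locn SB X RSB εSB κSB KbarSB TSB SXS ASB DS ρSB) (hRSB : R ≤ RSB)
    (hRA : JointWalkExpansion c₀ locn locn RA X R εR κR KbarR TRA SXR AR DR ρR)
    (hRB : JointWalkExpansion c₀ locn locn RB X RRB εRB κRB KbarRB TRB SXR ARB DR ρRB) (hRRB : R ≤ RRB)
    (hSdom : ∀ ω, DomBy (toB6 (torusGeom Nf 0 0 0) 0 True) (DS ω))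
    (hRdom : ∀ ω, DomBy (toB6 (torusGeom Nf 0 0 0) 0 True) (DR ω))
    {r τ : ℝ} (hr : 0 ≤ r) (hτ : 0 ≤ τ)
    (hdiffS : ∀ ω, ∀ σ₀ : TPt d N' → ℂ, (∀ j, ‖σ₀ j‖ ≤ Real.exp c₀.κ₁) → ∀ u ∈ ball (0 : E) R,
      ∀ i j, ‖TSB ω σ₀ u i j - TSA ω σ₀ u i j‖ ≤ r * (AS ω * Real.exp (-(ρS * DS ω (locp i) (locn j)))))
    (hdiffR : ∀ ω, ∀ σ₀ : TPt d N' → ℂ, (∀ j, ‖σ₀ j‖ ≤ Real.exp c₀.κ₁) → ∀ u ∈ ball (0 : E) R,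
      ∀ i j, ‖TRB ω σ₀ u i j - TRA ω σ₀ u i j‖ ≤ r * (AR ω * Real.exp (-(ρR * DR ω (locn i) (locn j)))))
    (hfib : ∀ y : UT Nf, (Finset.univ.filter fun k => locn k = y).card ≤ m)
    (hrow : RowSum (toB6 (torusGeom Nf 0 0 0) 0 True) σ₁ c₁) (hrow' : RowSum (toB6 (torusGeom Nf 0 0 0) 0 True) σ' c')
    (hσ₁ : 0 ≤ σ₁) (hσ' : 0 ≤ σ') (hc₁ : 0 ≤ c₁) (hc' : 0 ≤ c')
    (hε : 0 ≤ ε) (hερ : ε ≤ ρ) (hρs : ρ + σ₁ ≤ ρs) (hρsR : ρs + σ₁ ≤ ρR) (hwR : ρR - εR ≤ ρ - ε)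
    (hKR : 0 ≤ KbarR) (hκs : 0 ≤ κs) (hκsR : κs ≤ κR) (hκsC : κs + σ' ≤ ρ - ε) (hκ : 0 ≤ κ) (hκC : κ ≤ ρ - ε)
    (hκκs : κ + σ' ≤ κs)
    (hq : (m * c₁) * ((m * c₁) * 1 * (1 * ((1 + τ * r) * KbarR)) * c') * c' < 1)
    (hρ' : 0 ≤ ρ') (hρ'ρ : ρ' ≤ ρ) (hρ'S : ρ' + σ₁ ≤ ρS) (hε' : 0 ≤ ε') (hwS : ρS - εS ≤ ρ' - ε') (hw1 : ρ - ε ≤ ρ' - ε')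
    (hKS : 0 ≤ KbarS) (hκ' : 0 ≤ κ') (hκ'κ : κ' ≤ κ) (hκ'S : κ' + σ' ≤ κS) :
    ∃ (W : Type) (T : W → (TPt d N' → ℂ) → E × ℂ → Matrix p n ℂ) (SX : Set W) (A : W → ℝ) (D : W → UT Nf → UT Nf → ℝ)
      (ρ₀ : ℝ), JointWalkExpansion c₀ locp locn
        (fun σ₀ (v : E × ℂ) => (SA σ₀ v.1 + (((τ / R : ℝ) : ℂ) * v.2) • (SB σ₀ v.1 - SA σ₀ v.1)) *
          ((1 : Matrix n n ℂ) + (-1 : ℂ) • (RA σ₀ v.1 + (((τ / R : ℝ) : ℂ) * v.2) • (RB σ₀ v.1 - RA σ₀ v.1)))⁻¹) X R ε' κ'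
        ((m * c₁) * ((1 + τ * r) * KbarS) *
          (1 * (1 - (m * c₁) * ((m * c₁) * 1 * (1 * ((1 + τ * r) * KbarR)) * c') * c')⁻¹) * c') T SX A D ρ₀ ∧
      ∀ ω, DomBy (toB6 (torusGeom Nf 0 0 0) 0 True) (D ω) :=
  have h1 : 0 ≤ 1 + τ * r := by positivity
  jointWalkExpansion_glue (jointWalkExpansion_pencilParam hSA hSB hRSB hr hτ hdiffS)
    (jointWalkExpansion_pencilParam hRA hRB hRRB hr hτ hdiffR) hSdom hRdom hfib hrow hrow' hσ₁ hσ' hc₁ hc' hε hερ hρs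
    hρsR hwR (mul_nonneg h1 hKR) hκs hκsR hκsC hκ hκC hκκs hq hρ' hρ'ρ hρ'S hε' hwS hw1 (mul_nonneg h1 hKS) hκ' hκ'κ hκ'S

end Summit.QuantumFields.BalabanUV.T4Continuum.Spine.NE5.TwoRunPencilGlue

end
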